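import Summits.ValiantsHypothesis.ValiantsHypothesis.Theorems.NcPerWordTensor
import HarnessLib

/-!
# Nisan's width bound transported to the word tensor of `ncPerPoly n` (decided rung, literal form)

Decomposition workshop `decomp-valiant`, lens 6 «restricted-models lifting axis», gen 4, move K5b′ of
the node `CommutativityDial`. `Theorems.NisanPermanent` decided the bottom rung of the commutativity dial
on Nisan's row-alphabet tensor `perWord n` (`ncAbpWidth = C(n,⌊n/2⌋)`); `Theorems.NcPerWordTensor`
identified the coefficients of the dial's actual target `CommutativityDial.ncPerPoly n`. Here the two are
composed: `ncPerTensor n : (Fin n → Fin (n·n)) → F` is the length-`n` word tensor of `ncPerPoly n` over its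
own alphabet `Fin n × Fin n ≃ Fin (n·n)` (BDI's tensor format), and

* `rank_wordFlattening_ncPerTensor` — every Nisan flattening `M_a` of it has rank EXACTLY `C(n,a)`: its row
  space is the image of `perWord`'s row space under the injective "extension by zero along column-consistent
  suffixes" `extV` (rows at inconsistent prefixes vanish);
* `hasNcABPWidthLE_ncPerTensor_iff` — THE DECIDED RUNG IN LITERAL FORM: the word tensor of the ordered
  permanent `ncPerPoly n` has a (homogeneous, transfer-matrix) noncommutative ABP of width `≤ w`
  (`BDI2020.HasNcABPWidthLE`) iff `C(n,⌊n/2⌋) ≤ w`; `ncAbpWidth_ncPerTensor` — its nc-ABP width is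
  `C(n,⌊n/2⌋)` on the nose (`≥ 2ⁿ/(n+1)`): at the ABP/formula level the hardness conjunct `A_nc` of the dial
  is TRUE and the lift `B_nc` is where all content sits (determinant has polynomial commutative ABPs).

HONEST FRAMING: Nisan 1991 reproved in the tree's coordinates; nothing here bears on `VP ≠ VNP`.

## References
* [Nisan1991Noncommutative] N. Nisan, Lower bounds for non-commutative computation, STOC 1991, Thm 1, §4.
* [BlaserDorflerIkenmeyer2020] M. Bläser, J. Dörfler, C. Ikenmeyer, On the complexity of evaluating highest
  weight vectors, CCC 2021 (arXiv 2020), Prop 6.6.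
-/

namespace Summit.ValiantsHypothesis.ValiantsHypothesis.Theorems.NcPerTensorWidth

open Literature.Computability.AlgebraicComplexity hiding ncPerPoly
open Summit.ValiantsHypothesis.ValiantsHypothesis.Theorems.CommutativityDial (ncPerPoly)
open Summit.ValiantsHypothesis.ValiantsHypothesis.Theorems.NisanPermanent (perWord
  rank_wordFlattening_perWord)
open Summit.ValiantsHypothesis.ValiantsHypothesis.Theorems.NcPerWordTensor (coeff_equiv_ncPerPoly_ofFn)

universe u

variable {F : Type u} [Field F]

/-- The length-`n` WORD TENSOR of the ordered permanent `ncPerPoly n` over its own alphabet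
`Fin n × Fin n ≃ Fin (n·n)` (letters decoded by `finProdFinEquiv`), in BDI's tensor format.
[cite: Nisan1991Noncommutative, §4] -/
noncomputable def ncPerTensor (n : ℕ) : (Fin n → Fin (n * n)) → F := fun w =>
  (FreeAlgebra.equivMonoidAlgebraFreeMonoid (ncPerPoly (k := F) n)).coeff
    (FreeMonoid.ofList (List.ofFn fun t => finProdFinEquiv.symm (w t)))

/-- The word tensor unfolded through the coefficient bridge: `perWord` of the rows on column-consistent
words, `0` elsewhere. [cite: Nisan1991Noncommutative, §4] -/
theorem ncPerTensor_apply (n : ℕ) (w : Fin n → Fin (n * n)) :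
    ncPerTensor (F := F) n w = if ∀ t, (finProdFinEquiv.symm (w t)).2 = t
      then perWord F n (fun t => (finProdFinEquiv.symm (w t)).1) else 0 :=
  coeff_equiv_ncPerPoly_ofFn n _

section Cut

variable {n a b : ℕ} (h : a + b = n)

/-- Extension by zero along column-consistent suffixes: a function of row-suffixes `Fin b → Fin n` becomes
a function of letter-suffixes `Fin b → Fin (n·n)` supported on the suffixes whose letter in position `j`
lies in column `a + j`. [cite: Nisan1991Noncommutative, §4] -/
noncomputable def extV (h : a + b = n) : ((Fin b → Fin n) → F) →ₗ[F] ((Fin b → Fin (n * n)) → F) where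
  toFun f v := if ∀ j, (finProdFinEquiv.symm (v j)).2 = Fin.cast h (Fin.natAdd a j)
    then f (fun j => (finProdFinEquiv.symm (v j)).1) else 0
  map_add' f g := by
    funext v
    simp only [Pi.add_apply]
    split_ifs <;> simp
  map_smul' c f := by
    funext v
    simp only [Pi.smul_apply, smul_eq_mul, RingHom.id_apply]
    split_ifs <;> simp

/-- The consistent letter-suffix with prescribed rows. [cite: Nisan1991Noncommutative, §4] -/
def liftV (h : a + b = n) (r : Fin b → Fin n) : Fin b → Fin (n * n) :=
  fun j => finProdFinEquiv (r j, Fin.cast h (Fin.natAdd a j))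

/-- The consistent letter-prefix with prescribed rows. [cite: Nisan1991Noncommutative, §4] -/
def liftU (h : a + b = n) (r : Fin a → Fin n) : Fin a → Fin (n * n) :=
  fun i => finProdFinEquiv (r i, Fin.cast h (Fin.castAdd b i))

/-- `extV f` takes the value `f r` at the consistent suffix with rows `r`. [cite: Nisan1991Noncommutative, §4] -/
theorem extV_liftV (f : (Fin b → Fin n) → F) (r : Fin b → Fin n) : extV (F := F) h f (liftV h r) = f r := by
  show (if _ then _ else _) = _
  simp [liftV]

/-- Extension by zero is injective. [cite: Nisan1991Noncommutative, §4] -/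
theorem extV_injective : Function.Injective (extV (F := F) h) := by
  intro f g hfg
  funext r
  rw [← extV_liftV h f r, ← extV_liftV h g r, hfg]

/-- Column-consistency of a concatenated word splits into consistency of prefix and suffix.
[cite: Nisan1991Noncommutative, §4] -/
theorem cons_append_iff (u : Fin a → Fin (n * n)) (v : Fin b → Fin (n * n)) :
    (∀ t : Fin n, (finProdFinEquiv.symm (Fin.append u v (Fin.cast h.symm t))).2 = t) ↔
      (∀ i, (finProdFinEquiv.symm (u i)).2 = Fin.cast h (Fin.castAdd b i)) ∧
        (∀ j, (finProdFinEquiv.symm (v j)).2 = Fin.cast h (Fin.natAdd a j)) := by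
  have key : (∀ t : Fin n, (finProdFinEquiv.symm (Fin.append u v (Fin.cast h.symm t))).2 = t) ↔
      ∀ i : Fin (a + b), (finProdFinEquiv.symm (Fin.append u v i)).2 = Fin.cast h i :=
    ⟨fun H i => H (Fin.cast h i), fun H t => H (Fin.cast h.symm t)⟩
  rw [key, Fin.forall_fin_add]
  simp only [Fin.append_left, Fin.append_right]

/-- The rows of a concatenated word are the concatenation of the rows. [cite: Nisan1991Noncommutative, §4] -/
theorem rows_append (u : Fin a → Fin (n * n)) (v : Fin b → Fin (n * n)) :
    (fun t : Fin n => (finProdFinEquiv.symm (Fin.append u v (Fin.cast h.symm t))).1) =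
      fun t => Fin.append (fun i => (finProdFinEquiv.symm (u i)).1)
        (fun j => (finProdFinEquiv.symm (v j)).1) (Fin.cast h.symm t) := by
  funext t
  generalize Fin.cast h.symm t = i
  induction i using Fin.addCases with
  | left i => simp only [Fin.append_left]
  | right j => simp only [Fin.append_right]

/-- ROW FORMULA: the row of Nisan's matrix of `ncPerTensor n` at a letter-prefix `u` is zero unless `u` is
column-consistent, and then it is the extension by zero of the row of `perWord`'s matrix at the rows
of `u`. [cite: Nisan1991Noncommutative, §4] -/
theorem row_wordFlattening_ncPerTensor (u : Fin a → Fin (n * n)) :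
    wordFlattening (ncPerTensor (F := F) n) a b h u =
      if ∀ i, (finProdFinEquiv.symm (u i)).2 = Fin.cast h (Fin.castAdd b i)
      then extV h (wordFlattening (perWord F n) a b h (fun i => (finProdFinEquiv.symm (u i)).1))
      else 0 := by
  funext v
  rw [wordFlattening_apply, ncPerTensor_apply, rows_append h]
  by_cases hu : ∀ i, (finProdFinEquiv.symm (u i)).2 = Fin.cast h (Fin.castAdd b i)
  · rw [if_pos hu]
    show _ = if _ then _ else _
    rw [wordFlattening_apply]
    by_cases hv : ∀ j, (finProdFinEquiv.symm (v j)).2 = Fin.cast h (Fin.natAdd a j)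
    · rw [if_pos hv, if_pos ((cons_append_iff h u v).2 ⟨hu, hv⟩)]
    · rw [if_neg hv, if_neg fun H => hv ((cons_append_iff h u v).1 H).2]
  · rw [if_neg hu, Pi.zero_apply, if_neg fun H => hu ((cons_append_iff h u v).1 H).1]

/-- The consistent prefix `liftU r` is consistent and has rows `r`; its row is the extension of `perWord`'s
row at `r`. [cite: Nisan1991Noncommutative, §4] -/
theorem row_wordFlattening_ncPerTensor_liftU (r : Fin a → Fin n) :
    wordFlattening (ncPerTensor (F := F) n) a b h (liftU h r) =
      extV h (wordFlattening (perWord F n) a b h r) := by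
  rw [row_wordFlattening_ncPerTensor, if_pos]
  · simp [liftU]
  · simp [liftU]

/-- ROW SPACES: the row space of `M_a(ncPerTensor n)` is the image of the row space of `M_a(perWord n)`
under the injective extension `extV`. [cite: Nisan1991Noncommutative, §4] -/
theorem span_rows_ncPerTensor :
    Submodule.span F (Set.range (wordFlattening (ncPerTensor (F := F) n) a b h).row) =
      (Submodule.span F (Set.range (wordFlattening (perWord F n) a b h).row)).map (extV h) := by
  rw [← Submodule.span_image]
  apply le_antisymm
  · rw [Submodule.span_le]
    rintro _ ⟨u, rfl⟩
    have hrow : (wordFlattening (ncPerTensor (F := F) n) a b h).row u =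
        wordFlattening (ncPerTensor (F := F) n) a b h u := rfl
    rw [hrow, row_wordFlattening_ncPerTensor h]
    split_ifs with hu
    · exact Submodule.subset_span ⟨_, ⟨_, rfl⟩, rfl⟩
    · exact Submodule.zero_mem _
  · refine Submodule.span_mono ?_
    rintro _ ⟨_, ⟨r, rfl⟩, rfl⟩
    refine ⟨liftU h r, ?_⟩
    show wordFlattening (ncPerTensor (F := F) n) a b h (liftU h r) =
      extV h (wordFlattening (perWord F n) a b h r)
    rw [row_wordFlattening_ncPerTensor_liftU]

/-- **RANK**: every Nisan flattening of the word tensor of `ncPerPoly n` has rank exactly `C(n,a)`.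
[cite: Nisan1991Noncommutative, §4] -/
theorem rank_wordFlattening_ncPerTensor :
    (wordFlattening (ncPerTensor (F := F) n) a b h).rank = n.choose a := by
  rw [Matrix.rank_eq_finrank_span_row, span_rows_ncPerTensor h,
    ← (Submodule.equivMapOfInjective _ (extV_injective (F := F) h) _).finrank_eq,
    ← Matrix.rank_eq_finrank_span_row, rank_wordFlattening_perWord h]

end Cut

/-- **THE DECIDED BOTTOM RUNG, LITERAL FORM** (Nisan 1991, tight): the word tensor of the ordered permanent
`ncPerPoly n` — the very free-algebra element `A_nc = PerNotNcVP` speaks about — has a noncommutative ABP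
of width `≤ w` iff `C(n,⌊n/2⌋) ≤ w`.
[cite: Nisan1991Noncommutative, Thm 1, §4; BlaserDorflerIkenmeyer2020, Prop 12 (arXiv; = CCC 2021 Prop 6.6)] -/
theorem hasNcABPWidthLE_ncPerTensor_iff (n w : ℕ) :
    BDI2020.HasNcABPWidthLE w (ncPerTensor (F := F) n) ↔ n.choose (n / 2) ≤ w := by
  rw [BDI2020.hasNcABPWidthLE_iff_wordTTRank_le, wordTTRank_le_iff]
  constructor
  · intro H
    have := H (n / 2) (n - n / 2) (by omega)
    rwa [rank_wordFlattening_ncPerTensor] at this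
  · intro hw a b h
    rw [rank_wordFlattening_ncPerTensor]
    exact (Nat.choose_le_middle a n).trans hw

/-- Corollary: the nc-ABP width of the ordered permanent's word tensor is `C(n,⌊n/2⌋)` on the nose.
[cite: Nisan1991Noncommutative, Thm 1, §4] -/
theorem ncAbpWidth_ncPerTensor (n : ℕ) :
    BDI2020.ncAbpWidth (ncPerTensor (F := F) n) = n.choose (n / 2) := by
  apply le_antisymm
  · exact BDI2020.ncAbpWidth_le ((hasNcABPWidthLE_ncPerTensor_iff n _).mpr le_rfl)
  · exact le_csInf ⟨_, (hasNcABPWidthLE_ncPerTensor_iff n _).mpr le_rfl⟩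
      fun w hw => (hasNcABPWidthLE_ncPerTensor_iff n w).mp hw

end Summit.ValiantsHypothesis.ValiantsHypothesis.Theorems.NcPerTensorWidth
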